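import Summits.KontsevichZagierPeriods.KontsevichZagierPeriods.Theorems.HurwitzMicroSectorsNormalFormPrincipleDilogExistsBoxAtoms
import Literature.NumberTheory.Transcendental.KZProductIdeal
import Literature.NumberTheory.Transcendental.KZDominatedFamilyRelations

/-!
# `NormalFormPrinciple` (stmt-KontsevichZagierPeriods-3869), line `SketchIdeator1` —
# leaf `stub_boxRigidity`, layer `L2W3`: the shuffle dissection of the prism

Pure proof file (registered sub-goal `l2w3_prism_shuffle` of the layer `L2W3` = level-2 weight-3
descent, lead seat c9; `--supports` the crux). SHUFFLE PRODUCTS as dissections: the prism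
`P = {0 < t₁ < t₀ < 1} × {0 < t₂ < 1}` carrying a product integrand `f(t₀) g(t₁) h(t₂)` (value
`(∫∫ f g) · (∫ h)`) is cut by the two Lebesgue-null planes `{t₂ = t₁}`, `{t₂ = t₀}` into three
open simplices according to the position of `t₂`:

* `P₁ = {t₂ < t₁ < t₀}` — the decreasing simplex `Δ = {0 < t₂ < t₁ < t₀ < 1}` itself, word
  `f g h`;
* `P₂ = {t₁ < t₂ < t₀}` — along the coordinate swap `1 ↔ 2` this is `Δ` with the word `f h g`;
* `P₃ = {t₁ < t₀ < t₂}` — along the cyclic permutation `(finRotate 3)⁻¹` this is `Δ` with the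
  word `h f g`.

Hence `[P, f g ⊗ h] − [Δ, fgh] − [Δ, fhg] − [Δ, hfg] ∈ KZ.relations` (the shuffle `(fg) ш h`),
for GIVEN representations `TP`, `W1`, `W2`, `W3` with these domains and integrands (EqOn form;
`f`, `g`, `h` arbitrary real functions). Chain of moves: restriction of `TP` off the two null
planes (rule (1), `KZ.IntegralRep.of_sub_of_restrict_mem_relations`; the planes are the zero sets
of the nonzero `ℚ`-polynomials `X₂ − X₁`, `X₂ − X₀`, null by `volume_setOf_aeval_eq_zero`); two
domain-additivity moves (rule (1a), `KZ.domainAddRel`) splitting `P₁ ⊔ (P₂ ⊔ P₃)` into its three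
pairwise disjoint pieces; and two coordinate-permutation moves (rule (2),
`KZ.of_sub_of_reindex_mem_relations`) identifying `[W2]`, `[W3]` with the pieces over `P₂`, `P₃`.

References: M. Kontsevich, D. Zagier, *Periods* (2001), §1.1–1.2, rules (1), (2). No definitions
are introduced.
-/

noncomputable section

open MeasureTheory Set
open Literature.NumberTheory.Transcendental Literature.NumberTheory.Transcendental.KZ
open Literature.ModelTheory.ExponentialFields (IsSemialgebraic)

namespace Summit.KontsevichZagierPeriods.HurwitzMicroSectors.NormalFormPrinciple.PiBox.M3

/-! ## Null planes `{tᵢ = tⱼ}` -/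

/-- A plane `{t | t i = t j}` (`i ≠ j`) in `ℝ³` is Lebesgue-null: it is the zero set of the
nonzero `ℚ`-polynomial `Xᵢ − Xⱼ`. [folklore] -/
theorem l2s_volume_setOf_apply_eq_apply (i j : Fin 3) (hij : i ≠ j) :
    volume {t : Fin 3 → ℝ | t i = t j} = 0 := by
  have hq : MvPolynomial.map (algebraMap ℚ ℝ)
      (MvPolynomial.X i - MvPolynomial.X j : MvPolynomial (Fin 3) ℚ) ≠ 0 := by
    rw [map_sub, MvPolynomial.map_X, MvPolynomial.map_X]
    exact sub_ne_zero.mpr (MvPolynomial.X_injective.ne hij)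
  simpa [sub_eq_zero] using volume_setOf_aeval_eq_zero
    (MvPolynomial.X i - MvPolynomial.X j : MvPolynomial (Fin 3) ℚ) hq

/-! ## The swapped simplex `P₂` and the rotated simplex `P₃` -/

/-- The domain of a representation over `Δ = {0 < t₂ < t₁ < t₀ < 1}` reindexed along
`Equiv.swap 1 2` is `P₂ = {0 < t₁ < t₂ < t₀ < 1}`. [folklore] -/
theorem l2s_reindex_swap_domain (W : IntegralRep 3)
    (hWd : W.domain = {t | 0 < t 2 ∧ t 2 < t 1 ∧ t 1 < t 0 ∧ t 0 < 1}) :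
    (W.reindex (Equiv.swap (1 : Fin 3) 2)).domain =
      {t | 0 < t 1 ∧ t 1 < t 2 ∧ t 2 < t 0 ∧ t 0 < 1} := by
  have hs0 : Equiv.swap (1 : Fin 3) 2 0 = 0 := by decide
  ext w
  simp only [IntegralRep.reindex_domain, hWd, mem_setOf_eq, Equiv.swap_apply_left,
    Equiv.swap_apply_right, hs0]

/-- The integrand of a representation of the word `f h g` over `Δ` reindexed along
`Equiv.swap 1 2` agrees with the product `f(t₀) g(t₁) h(t₂)` on its domain. [folklore] -/
theorem l2s_reindex_swap_integrand (f g h : ℝ → ℝ) (W : IntegralRep 3)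
    (hWi : EqOn W.integrand (fun t => f (t 0) * h (t 1) * g (t 2)) W.domain) :
    EqOn (W.reindex (Equiv.swap (1 : Fin 3) 2)).integrand
      (fun t => f (t 0) * g (t 1) * h (t 2))
      (W.reindex (Equiv.swap (1 : Fin 3) 2)).domain := by
  intro w hw
  have hw' : (fun i => w (Equiv.swap (1 : Fin 3) 2 i)) ∈ W.domain := by
    rw [IntegralRep.reindex_domain] at hw
    exact hw
  rw [IntegralRep.reindex_integrand]
  show W.integrand (fun i => w (Equiv.swap (1 : Fin 3) 2 i)) = f (w 0) * g (w 1) * h (w 2)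
  have hs0 : Equiv.swap (1 : Fin 3) 2 0 = 0 := by decide
  rw [hWi hw']
  simp only [Equiv.swap_apply_left, Equiv.swap_apply_right, hs0]
  ring

/-- The domain of a representation over `Δ = {0 < t₂ < t₁ < t₀ < 1}` reindexed along the cyclic
permutation `(finRotate 3)⁻¹` (`0 ↦ 2`, `1 ↦ 0`, `2 ↦ 1`) is `P₃ = {0 < t₁ < t₀ < t₂ < 1}`.
[folklore] -/
theorem l2s_reindex_rot_domain (W : IntegralRep 3)
    (hWd : W.domain = {t | 0 < t 2 ∧ t 2 < t 1 ∧ t 1 < t 0 ∧ t 0 < 1}) :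
    (W.reindex (finRotate 3).symm).domain =
      {t | 0 < t 1 ∧ t 1 < t 0 ∧ t 0 < t 2 ∧ t 2 < 1} := by
  have he : (finRotate 3).symm 0 = 2 ∧ (finRotate 3).symm 1 = 0 ∧ (finRotate 3).symm 2 = 1 := by
    decide
  ext w
  simp only [IntegralRep.reindex_domain, hWd, mem_setOf_eq, he.1, he.2.1, he.2.2]

/-- The integrand of a representation of the word `h f g` over `Δ` reindexed along
`(finRotate 3)⁻¹` agrees with the product `f(t₀) g(t₁) h(t₂)` on its domain. [folklore] -/
theorem l2s_reindex_rot_integrand (f g h : ℝ → ℝ) (W : IntegralRep 3)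
    (hWi : EqOn W.integrand (fun t => h (t 0) * f (t 1) * g (t 2)) W.domain) :
    EqOn (W.reindex (finRotate 3).symm).integrand
      (fun t => f (t 0) * g (t 1) * h (t 2))
      (W.reindex (finRotate 3).symm).domain := by
  intro w hw
  have hw' : (fun i => w ((finRotate 3).symm i)) ∈ W.domain := by
    rw [IntegralRep.reindex_domain] at hw
    exact hw
  rw [IntegralRep.reindex_integrand]
  show W.integrand (fun i => w ((finRotate 3).symm i)) = f (w 0) * g (w 1) * h (w 2)
  have he : (finRotate 3).symm 0 = 2 ∧ (finRotate 3).symm 1 = 0 ∧ (finRotate 3).symm 2 = 1 := by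
    decide
  rw [hWi hw']
  simp only [he.1, he.2.1, he.2.2]
  ring

/-! ## The registered sub-goal -/

/-- **Stub L5 (`l2w3_prism_shuffle`; registered sub-goal of stmt-KontsevichZagierPeriods-3869,
line `SketchIdeator1`, layer `L2W3`).** The shuffle product `(f g) ш h` as a dissection: for
representations `TP = [P, ·]` over the prism `P = {0 < t₁ < t₀ < 1, 0 < t₂ < 1}` and
`W1, W2, W3 = [Δ, ·]` over the decreasing simplex `Δ = {0 < t₂ < t₁ < t₀ < 1}` whose integrands
agree on their domains with `f(t₀) g(t₁) h(t₂)`, `f(t₀) g(t₁) h(t₂)`, `f(t₀) h(t₁) g(t₂)`,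
`h(t₀) f(t₁) g(t₂)` respectively, `[TP] − [W1] − [W2] − [W3] ∈ KZ.relations`: restrict `TP` off
the null planes `{t₂ = t₁}`, `{t₂ = t₀}` (rule (1)), split the rest into the three simplices
`P₁ = Δ`, `P₂ = {t₁ < t₂ < t₀}`, `P₃ = {t₁ < t₀ < t₂}` (rule (1a), twice), and carry `[W2]`,
`[W3]` onto the pieces over `P₂`, `P₃` by the coordinate permutations `1 ↔ 2` and
`(finRotate 3)⁻¹` (rule (2), `KZ.of_sub_of_reindex_mem_relations`).
[cite: KontsevichZagier2001, §1.2 rules (1), (2)] -/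
theorem l2w3_prism_shuffle :
    ∀ (f g h : ℝ → ℝ) (TP W1 W2 W3 : IntegralRep 3),
      TP.domain = {t | 0 < t 1 ∧ t 1 < t 0 ∧ t 0 < 1 ∧ 0 < t 2 ∧ t 2 < 1} →
      EqOn TP.integrand (fun t => f (t 0) * g (t 1) * h (t 2)) TP.domain →
      W1.domain = {t | 0 < t 2 ∧ t 2 < t 1 ∧ t 1 < t 0 ∧ t 0 < 1} →
      EqOn W1.integrand (fun t => f (t 0) * g (t 1) * h (t 2)) W1.domain →
      W2.domain = {t | 0 < t 2 ∧ t 2 < t 1 ∧ t 1 < t 0 ∧ t 0 < 1} →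
      EqOn W2.integrand (fun t => f (t 0) * h (t 1) * g (t 2)) W2.domain →
      W3.domain = {t | 0 < t 2 ∧ t 2 < t 1 ∧ t 1 < t 0 ∧ t 0 < 1} →
      EqOn W3.integrand (fun t => h (t 0) * f (t 1) * g (t 2)) W3.domain →
      of TP - of W1 - of W2 - of W3 ∈ relations := by
  intro f g h TP W1 W2 W3 hTPd hTPi hW1d hW1i hW2d hW2i hW3d hW3i
  -- the permutation moves (rule 2): `[W2] − [W2 ∘ swap]` and `[W3] − [W3 ∘ rot]`
  have h2d := l2s_reindex_swap_domain W2 hW2d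
  have h2i := l2s_reindex_swap_integrand f g h W2 hW2i
  have e2 : of W2 - of (W2.reindex (Equiv.swap (1 : Fin 3) 2)) ∈ relations :=
    of_sub_of_reindex_mem_relations W2 (Equiv.swap (1 : Fin 3) 2)
  generalize W2.reindex (Equiv.swap (1 : Fin 3) 2) = V2 at h2d h2i e2
  have h3d := l2s_reindex_rot_domain W3 hW3d
  have h3i := l2s_reindex_rot_integrand f g h W3 hW3i
  have e3 : of W3 - of (W3.reindex (finRotate 3).symm) ∈ relations :=
    of_sub_of_reindex_mem_relations W3 (finRotate 3).symm
  generalize W3.reindex (finRotate 3).symm = V3 at h3d h3i e3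
  -- the three pieces `P₁ = W1.domain`, `P₂ = V2.domain`, `P₃ = V3.domain` sit inside the prism
  have hsub1 : W1.domain ⊆ TP.domain := by
    rw [hW1d, hTPd]
    exact fun t ht =>
      ⟨ht.1.trans ht.2.1, ht.2.2.1, ht.2.2.2, ht.1, (ht.2.1.trans ht.2.2.1).trans ht.2.2.2⟩
  have hsub2 : V2.domain ⊆ TP.domain := by
    rw [h2d, hTPd]
    exact fun t ht =>
      ⟨ht.1, ht.2.1.trans ht.2.2.1, ht.2.2.2, ht.1.trans ht.2.1, ht.2.2.1.trans ht.2.2.2⟩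
  have hsub3 : V3.domain ⊆ TP.domain := by
    rw [h3d, hTPd]
    exact fun t ht =>
      ⟨ht.1, ht.2.1, ht.2.2.1.trans ht.2.2.2, (ht.1.trans ht.2.1).trans ht.2.2.1, ht.2.2.2⟩
  -- the subdomains `E₂₃ = P₂ ∪ P₃` and `E = P₁ ∪ E₂₃` of the prism
  have hE23 : IsSemialgebraic ℚ (V2.domain ∪ V3.domain) :=
    V2.isSemialgebraic_domain.union V3.isSemialgebraic_domain
  have hE23r : V2.domain ∪ V3.domain ⊆ TP.domain := union_subset hsub2 hsub3
  have hE : IsSemialgebraic ℚ (W1.domain ∪ (V2.domain ∪ V3.domain)) :=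
    W1.isSemialgebraic_domain.union hE23
  have hEr : W1.domain ∪ (V2.domain ∪ V3.domain) ⊆ TP.domain := union_subset hsub1 hE23r
  -- the two cutting planes are null
  have hplanes : volume ({t : Fin 3 → ℝ | t 2 = t 1} ∪ {t | t 2 = t 0}) = 0 :=
    measure_union_null (l2s_volume_setOf_apply_eq_apply 2 1 (by decide))
      (l2s_volume_setOf_apply_eq_apply 2 0 (by decide))
  -- the complement of the three pieces in the prism lies on the two planes
  have hvol : volume (TP.domain \ (W1.domain ∪ (V2.domain ∪ V3.domain))) = 0 := by
    refine measure_mono_null (fun t ht => ?_) hplanes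
    rw [hTPd, hW1d, h2d, h3d] at ht
    obtain ⟨⟨hz1, h10, h01, hz2, h21⟩, hn⟩ := ht
    rcases lt_trichotomy (t 2) (t 1) with hlt | heq | hgt
    · exact absurd (Or.inl ⟨hz2, hlt, h10, h01⟩) hn
    · exact Or.inl heq
    · rcases lt_trichotomy (t 2) (t 0) with hlt' | heq' | hgt'
      · exact absurd (Or.inr (Or.inl ⟨hz1, hgt, hlt', h01⟩)) hn
      · exact Or.inr heq'
      · exact absurd (Or.inr (Or.inr ⟨hz1, h10, hgt', h21⟩)) hn
  -- the pieces are pairwise disjoint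
  have hint1 : volume (W1.domain ∩ (V2.domain ∪ V3.domain)) = 0 := by
    refine measure_mono_null (fun t ht => ?_) hplanes
    rw [hW1d, h2d, h3d] at ht
    obtain ⟨⟨_, h21, h10, _⟩, hB | hC⟩ := ht
    · exact absurd (h21.trans hB.2.1) (lt_irrefl _)
    · exact absurd ((h21.trans h10).trans hC.2.2.1) (lt_irrefl _)
  have hint23 : volume (V2.domain ∩ V3.domain) = 0 := by
    refine measure_mono_null (fun t ht => ?_) hplanes
    rw [h2d, h3d] at ht
    exact absurd (ht.1.2.2.1.trans ht.2.2.2.1) (lt_irrefl _)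
  -- move 0 (rule 1): `[TP] − [TP|E]`, `E` co-null in `P`
  have e0 : of TP - of (TP.restrict _ hE hEr) ∈ relations :=
    TP.of_sub_of_restrict_mem_relations hE hEr hvol
  -- move 1 (rule 1a): `[TP|E] − [W1] − [TP|E₂₃]`
  have e1 : of (TP.restrict _ hE hEr) - of W1 - of (TP.restrict _ hE23 hE23r) ∈ relations :=
    domainAddRel_subset_relations ⟨3, TP.restrict _ hE hEr, W1, TP.restrict _ hE23 hE23r, rfl,
      (by rw [KZ.IntegralRep.domain_restrict]; exact hint1),
      fun t ht => (hTPi (hsub1 ht)).trans (hW1i ht).symm, fun _ _ => rfl, rfl⟩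
  -- move 2 (rule 1a): `[TP|E₂₃] − [V2] − [V3]`
  have e23 : of (TP.restrict _ hE23 hE23r) - of V2 - of V3 ∈ relations :=
    domainAddRel_subset_relations ⟨3, TP.restrict _ hE23 hE23r, V2, V3, rfl, hint23,
      fun t ht => (hTPi (hsub2 ht)).trans (h2i ht).symm,
      fun t ht => (hTPi (hsub3 ht)).trans (h3i ht).symm, rfl⟩
  -- bookkeeping
  have e : of TP - of W1 - of W2 - of W3 = (of TP - of (TP.restrict _ hE hEr)) +
      (of (TP.restrict _ hE hEr) - of W1 - of (TP.restrict _ hE23 hE23r)) +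
      (of (TP.restrict _ hE23 hE23r) - of V2 - of V3) - (of W2 - of V2) - (of W3 - of V3) := by
    abel
  rw [e]
  exact relations.sub_mem (relations.sub_mem
    (relations.add_mem (relations.add_mem e0 e1) e23) e2) e3

end Summit.KontsevichZagierPeriods.HurwitzMicroSectors.NormalFormPrinciple.PiBox.M3
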